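import Summits.ResolutionOfSingularities.ResolutionOfSingularities.Theorems.EquisingularLiftEquisingularLiftNatRouteCurrency
import Summits.ResolutionOfSingularities.ResolutionOfSingularities.Theorems.EquisingularLiftEquisingularLiftNatSplit
import Summits.ResolutionOfSingularities.ResolutionOfSingularities.Theorems.EquisingularLiftEquisingularLiftOfPrimeForms
import HarnessLib

/-!
# Crux `EquisingularLift` (stmt-ResolutionOfSingularities-15660) IN THE STUBS' CURRENCY OF EL♮: the EL conclusion block from `ELNatConclusionO`,
# the route decl from `ELNatConclusionO` at prime-form hypersurfaces `n ≥ 3`, and RUNG LC in EL currency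

leafhand-res-equisingularlift-6 g0 (prover, 2026-08-31; one-generation line-first hand on stmt-ResolutionOfSingularities-15660 / -20038 / -20148,
cell `pub/decomp-res`).  DEF-FREE; no `sorry`; standard axioms; ZERO named hypotheses; `--supports stmt-ResolutionOfSingularities-15660 --as helper`,
counted 0.  Companion of …NatRouteCurrency (the flat-text bridge `RouteCurrency.elNatAt_of_elnatO`, this hand) for the bookkeeping crux EL.

Every rung / residue stub of EL♮(3) / EL♮ concludes `ELNatConclusionO k n H ι` (towers of blow-ups of the FIXED ambient `ℙⁿ_O` in regular `O`-flat
centres, E1).  The crux `EquisingularLift` asks, per instance `(p, k, n, H, ι)`, for the EL block (SOME smooth proper ambient `P → Spec O`,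
`V(Y)_red ≅ H`, towers in regular centres without E1, irreducible last special fibre, regular reduced closure).  This file records:

* `elConclusion_of_elnatO` — PER INSTANCE, every `n`: `ELNatConclusionO k n H ι` ⇒ the EL block for `(H, ι)` (the bridge + ✓
  `EquisingularLiftNatBands.elConclusion_of_natConclusion`, …NatSplit);
* `equisingularLift_of_forall_elnatO` — the route decl `Theses.EquisingularLift.EquisingularLift` BY NAME from `ELNatConclusionO` at every instance
  of its hypotheses; ★ `equisingularLift_of_forall_elnatO_primeForms` — the same from `ELNatConclusionO` at the PRIME-FORM HYPERSURFACES
  `range ι = V₊(F)`, `F` prime of degree `e ≥ 1`, in `ℙⁿ`, `n ≥ 3` only (✓ `StrataSplit.equisingularLift_of_primeForms`, leafhand-5): the three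
  items 15660 / 20038 / 20148 now read ONE currency;
* ★ `el_largeChar_of_hyp` / `el_largeChar` — RUNG LC IN EL CURRENCY: for all `n, D` there is `M(n, D)` such that for every prime `p > M`, every
  algebraically closed `k` of characteristic `p` and every instance of the crux hypotheses with «`ι` an isomorphism ∨ `range ι` on a hypersurface
  of degree `≤ D`» (resp. at the honest cut `range ι = V₊(F)`, `F ≠ 0` of degree `d`), the EL block holds.

* ★ `hasResolution_largeChar_of_hyp` / `hasResolution_largeChar` (append #1) — **RESOLUTION OF SINGULARITIES FOR HYPERSURFACES OF BOUNDED DEGREE IN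
  LARGE CHARACTERISTIC**: for all `n, D` there is `M(n, D)` such that for every prime `p > M` and every algebraically closed `k` of characteristic `p`,
  every INTEGRAL closed `H ↪ ℙⁿ_k` with locally principal ideal lying on a hypersurface of degree `≤ D` (resp. every integral `H` with
  `range ι = V₊(F)`, `F ≠ 0` of degree `d`) satisfies `Scheme.HasResolution H` (✓ `el_largeChar(_of_hyp)` + ✓ `EquisingularLiftNatBands.hasResolution_of_elConclusion`);
  `elnatO_hasResolution` — per instance, every `p`: `ELNatConclusionO k n H ι → Scheme.HasResolution H` (the stubs' currency resolves its hypersurface).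

HONEST READING: plumbing and rungs only.  `M` is ineffective and degree-dependent; `EquisingularLift` / EL♮ / EL♮(3) quantify over ALL `H` at a
fixed `p` and are NOT proved; no registered stub (`stub_CJS2020Sequence`, `stub_CP2019General`, `stub_blowupModel_ge_five`; the EL♮ residues) is
closed; resolution of singularities in positive characteristic is NOT proved; nothing of [Hironaka2017] (a candidate under adjudication) is asserted
or used.  AI-written; AI review is weaker than expert review.
[cite: Liu2002, Thm. 8.1.19] [cite: Grothendieck1966, EGA IV₃ §8–§9] (method; index only)
-/

set_option linter.dupNamespace false -- mandated namespace `Summit.<Summit>.<Problem>` of this single-conjunct summit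

noncomputable section

open CategoryTheory CategoryTheory.Limits AlgebraicGeometry TopologicalSpace Topology
open MvPolynomial HomogeneousIdeal
open Literature.AlgebraicGeometry.Resolution Literature.AlgebraicGeometry.Motives
open Summit.ResolutionOfSingularities.ResolutionOfSingularities.Cruxes.EquisingularLiftNat.Sections
open Summit.ResolutionOfSingularities.ResolutionOfSingularities.Theorems

namespace Summit.ResolutionOfSingularities.ResolutionOfSingularities.Cruxes.EquisingularLift.StrataSplit

/-! ## The EL block from `ELNatConclusionO`, per instance -/

/-- **The EL conclusion block from the stubs' currency, per instance, every `n`.**  For an INTEGRAL `H` and a CLOSED IMMERSION `ι : H ⟶ ℙⁿ_k`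
(`k` algebraically closed of characteristic `p`): `ELNatConclusionO k n H ι` implies the conclusion block of `EquisingularLift` at `(H, ι)` —
the bridge ✓ `RouteCurrency.elNatAt_of_elnatO` followed by ✓ `EquisingularLiftNatBands.elConclusion_of_natConclusion` (fixed ambient `ℙⁿ_O`,
E1 chains ⇒ existential smooth proper ambient, `V(Y)_red ≅ H`, plain chains). [OURS · DEF-FREE] -/
theorem elConclusion_of_elnatO (p : ℕ) (k : Type) [Field k] [CharP k p] [IsAlgClosed k] (n : ℕ) (H : AlgebraicGeometry.Scheme.{0})
    (ι : H ⟶ (Literature.AlgebraicGeometry.Motives.projectiveSpace n k).left) (hι : AlgebraicGeometry.IsClosedImmersion ι)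
    (hH : AlgebraicGeometry.IsIntegral H) (h : ELNatConclusionO k n H ι) :
    ∃ (O : Type) (_ : CommRing O) (_ : IsDomain O) (_ : IsDiscreteValuationRing O) (_ : CharZero O) (P P' : AlgebraicGeometry.Scheme.{0}) (q : P ⟶ AlgebraicGeometry.Spec (.of O)) (Y : TopologicalSpace.Closeds P) (σ : P' ⟶ P) (S' : Set P'), AlgebraicGeometry.Smooth q ∧ AlgebraicGeometry.IsProper q ∧ (Y : Set P) ⊆ q ⁻¹' {IsLocalRing.closedPoint O} ∧ Nonempty ((AlgebraicGeometry.Scheme.IdealSheafData.vanishingIdeal Y).subscheme ≅ H) ∧ (∀ Q : (∀ X' : AlgebraicGeometry.Scheme.{0}, (X' ⟶ P) → Set X' → Prop), Q P (CategoryTheory.CategoryStruct.id P) (Y : Set P) → (∀ (X' X'' : AlgebraicGeometry.Scheme.{0}) (σ' : X' ⟶ P) (Y' : Set X') (C : X'.IdealSheafData) (τ : X'' ⟶ X'), Q X' σ' Y' → Literature.AlgebraicGeometry.Resolution.IsBlowup τ C → Literature.AlgebraicGeometry.Resolution.Scheme.IsRegular C.subscheme → σ' '' (C.support : Set X') ⊆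 {x : P | ¬ IsGenericPoint x (Y : Set P)} → Q X'' (CategoryTheory.CategoryStruct.comp τ σ') (closure (τ ⁻¹' (Y' \ (C.support : Set X'))))) → Q P' σ S') ∧ IsIrreducible ((CategoryTheory.CategoryStruct.comp σ q) ⁻¹' {IsLocalRing.closedPoint O}) ∧ Literature.AlgebraicGeometry.Resolution.Scheme.IsRegular (AlgebraicGeometry.Scheme.IdealSheafData.vanishingIdeal (⟨closure S', isClosed_closure⟩ : TopologicalSpace.Closeds P')).subscheme :=
  EquisingularLiftNatBands.elConclusion_of_natConclusion p k n H ι hι hH (RouteCurrency.elNatAt_of_elnatO p k n H ι hι hH h)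

/-! ## The route decl from `ELNatConclusionO` -/

/-- **`Theses.EquisingularLift.EquisingularLift` BY NAME from the stubs' currency**: if `ELNatConclusionO k n H ι` holds at every instance of the
crux hypotheses for every prime `p`, the decl holds. [OURS · DEF-FREE · pure plumbing] -/
theorem equisingularLift_of_forall_elnatO
    (h : ∀ p : ℕ, p.Prime → ∀ (k : Type) [Field k] [CharP k p] [IsAlgClosed k] (n : ℕ) (H : AlgebraicGeometry.Scheme.{0})
      (ι : H ⟶ (Literature.AlgebraicGeometry.Motives.projectiveSpace n k).left), AlgebraicGeometry.IsClosedImmersion ι →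
      AlgebraicGeometry.IsIntegral H →
      (∀ y : (Literature.AlgebraicGeometry.Motives.projectiveSpace n k).left,
        ∃ U : (Literature.AlgebraicGeometry.Motives.projectiveSpace n k).left.affineOpens,
          y ∈ (U : (Literature.AlgebraicGeometry.Motives.projectiveSpace n k).left.Opens) ∧ (ι.ker.ideal U).IsPrincipal) →
      ELNatConclusionO k n H ι) :
    Summit.ResolutionOfSingularities.ResolutionOfSingularities.Theses.EquisingularLift.EquisingularLift :=
  fun p hp k _ _ _ n H ι hι hH hloc => elConclusion_of_elnatO p k n H ι hι hH (h p hp k n H ι hι hH hloc)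

/-- ★ **`Theses.EquisingularLift.EquisingularLift` BY NAME from `ELNatConclusionO` at PRIME-FORM HYPERSURFACES in `ℙⁿ`, `n ≥ 3`.**  If
`ELNatConclusionO k n H ι` holds for every instance of the crux hypotheses with `3 ≤ n` and `range ι = V₊(F)`, `F` a PRIME form of degree `e ≥ 1`,
then the decl holds (`n ≤ 2` and the isomorphism case are in the tree: ✓ `equisingularLift_of_primeForms`).  The EL crux and the EL♮ residue stubs
now read the same currency. [OURS · DEF-FREE · pure reduction] -/
theorem equisingularLift_of_forall_elnatO_primeForms
    (h : ∀ p : ℕ, p.Prime → ∀ (k : Type) [Field k] [CharP k p] [IsAlgClosed k] (n : ℕ) (H : AlgebraicGeometry.Scheme.{0})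
      (ι : H ⟶ (Literature.AlgebraicGeometry.Motives.projectiveSpace n k).left), AlgebraicGeometry.IsClosedImmersion ι →
      AlgebraicGeometry.IsIntegral H →
      (∀ y : (Literature.AlgebraicGeometry.Motives.projectiveSpace n k).left,
        ∃ U : (Literature.AlgebraicGeometry.Motives.projectiveSpace n k).left.affineOpens,
          y ∈ (U : (Literature.AlgebraicGeometry.Motives.projectiveSpace n k).left.Opens) ∧ (ι.ker.ideal U).IsPrincipal) →
      3 ≤ n → ∀ (e : ℕ) (F : MvPolynomial (Fin (n + 1)) k), 0 < e → F.IsHomogeneous e → Prime F →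
      (letI := MvPolynomial.gradedAlgebra (σ := Fin (n + 1)) (R := k)
       Set.range ι = {x : AlgebraicGeometry.Proj (MvPolynomial.homogeneousSubmodule (Fin (n + 1)) k) | F ∈ x.asHomogeneousIdeal}) →
      ELNatConclusionO k n H ι) :
    Summit.ResolutionOfSingularities.ResolutionOfSingularities.Theses.EquisingularLift.EquisingularLift :=
  equisingularLift_of_primeForms fun p hp k _ _ _ n H ι hι hH hloc hn e F he hF hprime hrange =>
    elConclusion_of_elnatO p k n H ι hι hH (h p hp k n H ι hι hH hloc hn e F he hF hprime hrange)

/-! ## RUNG LC in EL currency -/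

/-- ★ **RUNG LC IN EL CURRENCY.**  For all `n, D` there is `M = M(n, D)` such that for every prime `p > M`, every algebraically closed `k` of
characteristic `p` and every `(H, ι)` satisfying the crux hypotheses of `EquisingularLift` (`ι` a closed immersion, `H` integral, `ker ι` locally
principal), IF `ι` is an isomorphism OR `range ι` lies on some hypersurface of degree `≤ D`, THEN the EL conclusion block holds at `(H, ι)`
(✓ `RouteCurrency.elNatAt_largeChar_of_hyp` + ✓ `elConclusion_of_natConclusion`).  A RUNG: `M` ineffective and degree-dependent; NOT
`EquisingularLift`; closes no registered stub. [OURS · DEF-FREE · ZERO named hypotheses] [cite: Grothendieck1966, EGA IV₃ §8–§9] (method; index only) -/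
theorem el_largeChar_of_hyp (n D : ℕ) :
    ∃ M : ℕ, ∀ (p : ℕ), p.Prime → ∀ (k : Type) [Field k] [CharP k p] [IsAlgClosed k], M < p →
      ∀ (H : AlgebraicGeometry.Scheme.{0}) (ι : H ⟶ (Literature.AlgebraicGeometry.Motives.projectiveSpace n k).left),
        AlgebraicGeometry.IsClosedImmersion ι → AlgebraicGeometry.IsIntegral H →
        (∀ y : (Literature.AlgebraicGeometry.Motives.projectiveSpace n k).left,
          ∃ U : (Literature.AlgebraicGeometry.Motives.projectiveSpace n k).left.affineOpens,
            y ∈ (U : (Literature.AlgebraicGeometry.Motives.projectiveSpace n k).left.Opens) ∧ (ι.ker.ideal U).IsPrincipal) →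
        (IsIso ι ∨ ∃ (e : ℕ) (G : MvPolynomial (Fin (n + 1)) k), e ≤ D ∧ G.IsHomogeneous e ∧ G ≠ 0 ∧
          letI := MvPolynomial.gradedAlgebra (σ := Fin (n + 1)) (R := k)
          Set.range ι ⊆ {x : AlgebraicGeometry.Proj (MvPolynomial.homogeneousSubmodule (Fin (n + 1)) k) | G ∈ x.asHomogeneousIdeal}) →
        ∃ (O : Type) (_ : CommRing O) (_ : IsDomain O) (_ : IsDiscreteValuationRing O) (_ : CharZero O) (P P' : AlgebraicGeometry.Scheme.{0}) (q : P ⟶ AlgebraicGeometry.Spec (.of O)) (Y : TopologicalSpace.Closeds P) (σ : P' ⟶ P) (S' : Set P'), AlgebraicGeometry.Smooth q ∧ AlgebraicGeometry.IsProper q ∧ (Y : Set P) ⊆ q ⁻¹' {IsLocalRing.closedPoint O} ∧ Nonempty ((AlgebraicGeometry.Scheme.IdealSheafData.vanishingIdeal Y).subscheme ≅ H) ∧ (∀ Q : (∀ X' : AlgebraicGeometry.Scheme.{0}, (X' ⟶ P) → Set X' → Prop), Q P (CategoryTheory.CategoryStruct.id P) (Y : Set P) → (∀ (X' X'' : AlgebraicGeometry.Scheme.{0})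 (σ' : X' ⟶ P) (Y' : Set X') (C : X'.IdealSheafData) (τ : X'' ⟶ X'), Q X' σ' Y' → Literature.AlgebraicGeometry.Resolution.IsBlowup τ C → Literature.AlgebraicGeometry.Resolution.Scheme.IsRegular C.subscheme → σ' '' (C.support : Set X') ⊆ {x : P | ¬ IsGenericPoint x (Y : Set P)} → Q X'' (CategoryTheory.CategoryStruct.comp τ σ') (closure (τ ⁻¹' (Y' \ (C.support : Set X'))))) → Q P' σ S') ∧ IsIrreducible ((CategoryTheory.CategoryStruct.comp σ q) ⁻¹' {IsLocalRing.closedPoint O}) ∧ Literature.AlgebraicGeometry.Resolution.Scheme.IsRegular (AlgebraicGeometry.Scheme.IdealSheafData.vanishingIdeal (⟨closure S', isClosed_closure⟩ : TopologicalSpace.Closeds P')).subscheme := by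
  obtain ⟨M, hM⟩ := RouteCurrency.elNatAt_largeChar_of_hyp n D
  exact ⟨M, fun p hp k _ _ _ hMp H ι hι hH hpr h =>
    EquisingularLiftNatBands.elConclusion_of_natConclusion p k n H ι hι hH (hM p hp k hMp H ι hι hH hpr h)⟩

/-- **RUNG LC in EL currency at the honest cut.**  For all `n, d` there is `M = M(n, d)` such that for every prime `p > M`, every algebraically
closed `k` of characteristic `p` and every CLOSED IMMERSION `ι : H ⟶ ℙⁿ_k` of an INTEGRAL `H` with `range ι = V₊(F)`, `F ≠ 0` homogeneous of
degree `d`, the EL conclusion block holds at `(H, ι)`. [OURS · DEF-FREE · ZERO named hypotheses] -/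
theorem el_largeChar (n d : ℕ) :
    ∃ M : ℕ, ∀ (p : ℕ), p.Prime → ∀ (k : Type) [Field k] [CharP k p] [IsAlgClosed k], M < p →
      ∀ (H : AlgebraicGeometry.Scheme.{0}) (ι : H ⟶ (Literature.AlgebraicGeometry.Motives.projectiveSpace n k).left)
        (F : MvPolynomial (Fin (n + 1)) k), F.IsHomogeneous d → AlgebraicGeometry.IsClosedImmersion ι →
        (AlgebraicGeometry.IsIntegral H ∧ F ≠ 0 ∧
          letI := MvPolynomial.gradedAlgebra (σ := Fin (n + 1)) (R := k)
          Set.range ι = {x : AlgebraicGeometry.Proj (MvPolynomial.homogeneousSubmodule (Fin (n + 1)) k) | F ∈ x.asHomogeneousIdeal}) →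
        ∃ (O : Type) (_ : CommRing O) (_ : IsDomain O) (_ : IsDiscreteValuationRing O) (_ : CharZero O) (P P' : AlgebraicGeometry.Scheme.{0}) (q : P ⟶ AlgebraicGeometry.Spec (.of O)) (Y : TopologicalSpace.Closeds P) (σ : P' ⟶ P) (S' : Set P'), AlgebraicGeometry.Smooth q ∧ AlgebraicGeometry.IsProper q ∧ (Y : Set P) ⊆ q ⁻¹' {IsLocalRing.closedPoint O} ∧ Nonempty ((AlgebraicGeometry.Scheme.IdealSheafData.vanishingIdeal Y).subscheme ≅ H) ∧ (∀ Q : (∀ X' : AlgebraicGeometry.Scheme.{0}, (X' ⟶ P) → Set X' → Prop), Q P (CategoryTheory.CategoryStruct.id P) (Y : Set P) → (∀ (X' X'' : AlgebraicGeometry.Scheme.{0}) (σ' : X' ⟶ P) (Y' : Set X') (C : X'.IdealSheafData) (τ : X'' ⟶ X'), Q X' σ' Y' → Literature.AlgebraicGeometry.Resolution.IsBlowup τ C → Literature.AlgebraicGeometry.Resolution.Scheme.IsRegular C.subscheme → σ' '' (C.support : Set X') ⊆ {x : P | ¬ IsGenericPoint x (Y : Set P)} → Q X'' (CategoryTheory.CategoryStruct.comp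 τ σ') (closure (τ ⁻¹' (Y' \ (C.support : Set X'))))) → Q P' σ S') ∧ IsIrreducible ((CategoryTheory.CategoryStruct.comp σ q) ⁻¹' {IsLocalRing.closedPoint O}) ∧ Literature.AlgebraicGeometry.Resolution.Scheme.IsRegular (AlgebraicGeometry.Scheme.IdealSheafData.vanishingIdeal (⟨closure S', isClosed_closure⟩ : TopologicalSpace.Closeds P')).subscheme := by
  obtain ⟨M, hM⟩ := RouteCurrency.elNatAt_largeChar n d
  exact ⟨M, fun p hp k _ _ _ hMp H ι F hF hι h =>
    EquisingularLiftNatBands.elConclusion_of_natConclusion p k n H ι hι h.1 (hM p hp k hMp H ι F hF hι h)⟩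

/-! ## Append #1 — non-embedded resolution from the stubs' currency; hypersurfaces of bounded degree in large characteristic -/

/-- **The stubs' currency resolves its hypersurface, per instance, every `p` and `n`.**  For an INTEGRAL `H` and a CLOSED IMMERSION `ι : H ⟶ ℙⁿ_k`:
`ELNatConclusionO k n H ι → Scheme.HasResolution H` (✓ `elConclusion_of_elnatO` + ✓ `EquisingularLiftNatBands.hasResolution_of_elConclusion`).
[OURS · DEF-FREE] -/
theorem elnatO_hasResolution (p : ℕ) (k : Type) [Field k] [CharP k p] [IsAlgClosed k] (n : ℕ) (H : AlgebraicGeometry.Scheme.{0})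
    (ι : H ⟶ (Literature.AlgebraicGeometry.Motives.projectiveSpace n k).left) (hι : AlgebraicGeometry.IsClosedImmersion ι)
    (hH : AlgebraicGeometry.IsIntegral H) (h : ELNatConclusionO k n H ι) :
    Literature.AlgebraicGeometry.Resolution.Scheme.HasResolution H :=
  EquisingularLiftNatBands.hasResolution_of_elConclusion H hH (elConclusion_of_elnatO p k n H ι hι hH h)

/-- ★ **RESOLUTION OF SINGULARITIES FOR INTEGRAL PROJECTIVE SUBSCHEMES WITH LOCALLY PRINCIPAL IDEAL ON A HYPERSURFACE OF BOUNDED DEGREE, IN LARGE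
CHARACTERISTIC.**  For all `n, D` there is `M = M(n, D)` such that for every prime `p > M`, every algebraically closed `k` of characteristic `p` and every
closed immersion `ι : H ⟶ ℙⁿ_k` of an INTEGRAL `H` with `ker ι` locally principal: if `ι` is an isomorphism or `range ι` lies on some hypersurface of
degree `≤ D`, then `H` admits a resolution of singularities (a proper birational `H' → H` with `H'` regular).  A RUNG of record (spreading out of
characteristic zero; `M` ineffective and degree-dependent) — NOT resolution in positive characteristic, which asks for ALL degrees at a FIXED `p`.
[OURS · DEF-FREE · ZERO named hypotheses] [cite: Grothendieck1966, EGA IV₃ §8–§9] (method; index only) -/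
theorem hasResolution_largeChar_of_hyp (n D : ℕ) :
    ∃ M : ℕ, ∀ (p : ℕ), p.Prime → ∀ (k : Type) [Field k] [CharP k p] [IsAlgClosed k], M < p →
      ∀ (H : AlgebraicGeometry.Scheme.{0}) (ι : H ⟶ (Literature.AlgebraicGeometry.Motives.projectiveSpace n k).left),
        AlgebraicGeometry.IsClosedImmersion ι → AlgebraicGeometry.IsIntegral H →
        (∀ y : (Literature.AlgebraicGeometry.Motives.projectiveSpace n k).left,
          ∃ U : (Literature.AlgebraicGeometry.Motives.projectiveSpace n k).left.affineOpens,
            y ∈ (U : (Literature.AlgebraicGeometry.Motives.projectiveSpace n k).left.Opens) ∧ (ι.ker.ideal U).IsPrincipal) →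
        (IsIso ι ∨ ∃ (e : ℕ) (G : MvPolynomial (Fin (n + 1)) k), e ≤ D ∧ G.IsHomogeneous e ∧ G ≠ 0 ∧
          letI := MvPolynomial.gradedAlgebra (σ := Fin (n + 1)) (R := k)
          Set.range ι ⊆ {x : AlgebraicGeometry.Proj (MvPolynomial.homogeneousSubmodule (Fin (n + 1)) k) | G ∈ x.asHomogeneousIdeal}) →
        Literature.AlgebraicGeometry.Resolution.Scheme.HasResolution H := by
  obtain ⟨M, hM⟩ := el_largeChar_of_hyp n D
  exact ⟨M, fun p hp k _ _ _ hMp H ι hι hH hpr h =>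
    EquisingularLiftNatBands.hasResolution_of_elConclusion H hH (hM p hp k hMp H ι hι hH hpr h)⟩

/-- ★ **RESOLUTION OF SINGULARITIES FOR INTEGRAL HYPERSURFACES OF DEGREE `d` IN `ℙⁿ`, IN CHARACTERISTIC `p > M(n, d)`.**  For all `n, d` there is
`M = M(n, d)` such that for every prime `p > M`, every algebraically closed `k` of characteristic `p` and every closed immersion `ι : H ⟶ ℙⁿ_k` of
an INTEGRAL `H` with `range ι = V₊(F)`, `F ≠ 0` homogeneous of degree `d`: `H` admits a resolution of singularities.  A RUNG of record (`M`
ineffective); NOT resolution in positive characteristic. [OURS · DEF-FREE · ZERO named hypotheses] -/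
theorem hasResolution_largeChar (n d : ℕ) :
    ∃ M : ℕ, ∀ (p : ℕ), p.Prime → ∀ (k : Type) [Field k] [CharP k p] [IsAlgClosed k], M < p →
      ∀ (H : AlgebraicGeometry.Scheme.{0}) (ι : H ⟶ (Literature.AlgebraicGeometry.Motives.projectiveSpace n k).left)
        (F : MvPolynomial (Fin (n + 1)) k), F.IsHomogeneous d → AlgebraicGeometry.IsClosedImmersion ι →
        (AlgebraicGeometry.IsIntegral H ∧ F ≠ 0 ∧
          letI := MvPolynomial.gradedAlgebra (σ := Fin (n + 1)) (R := k)
          Set.range ι = {x : AlgebraicGeometry.Proj (MvPolynomial.homogeneousSubmodule (Fin (n + 1)) k) | F ∈ x.asHomogeneousIdeal}) →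
        Literature.AlgebraicGeometry.Resolution.Scheme.HasResolution H := by
  obtain ⟨M, hM⟩ := el_largeChar n d
  exact ⟨M, fun p hp k _ _ _ hMp H ι F hF hι h =>
    EquisingularLiftNatBands.hasResolution_of_elConclusion H h.1 (hM p hp k hMp H ι F hF hι h)⟩

end Summit.ResolutionOfSingularities.ResolutionOfSingularities.Cruxes.EquisingularLift.StrataSplit

end
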